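import Mathlib.NumberTheory.LegendreSymbol.JacobiSymbol
import Mathlib.NumberTheory.LegendreSymbol.QuadraticChar.Basic
import Mathlib.Data.Nat.Squarefree
import HarnessLib

/-!
# Genus symbols on the level-`64` lattice of binary quadratic forms (Shintani lift, arithmetic part)

Arithmetic of the lattice `L = {ι(v) = [64v₀, 128v₁, v₂] = 64v₀X² + 128v₁XY + v₂Y² : v ∈ ℤ³}` of
binary quadratic forms used for the level-`64` Shintani theta lift of the congruent-number newform
(route towards Waldspurger's relation behind Tunnell's theorem,
`Literature.NumberTheory.EllipticCurves.Tunnell1983.Tunnell1983_waldspurger_chi2`; see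
`ShintaniSchwartzFourier`, `ShintaniThetaInversion` for the analytic side):

* `nQ v = 64v₁² - v₀v₂` — the reduced discriminant (`disc ι(v) = 256 nQ v`), its polar form `bQ`;
* `actInt a b c' d` — the right action `ι(v) ↦ ι(v) ∘ g` of `g = (a b; 64c' d) ∈ Γ₀(64)` in the
  coordinates `v` (`actInt_actInt`, `actEquiv`: a bijection of `ℤ³`; `nQ_actInt`: `n` is invariant);
* `coneSym p v` — the **local genus symbol** at an odd prime `p`: `0` unless `p ∣ n(v)` (then
  `ι(v) ≡ λℓ² (mod p)` is a cone vector), and then the Legendre symbol `(λ/p)` of the unit square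
  class represented by `ι(v)` (read off from `v₀` or, if `p ∣ v₀`, from `v₂`); the `p`-component of
  Gauss's generic character attached to the prime discriminant `p*` (Kohnen 1985 §1,
  Gross–Kohnen–Zagier II §1: `χ_D(Q)`; Shintani 1975 Thm. 2: a character `χ` of `L/NL`);
* `genusWt D v = χ₋₄(v₂) ∏_{p ∣ D} coneSym p v` — the weight `ω_D` of the `D`-th twisted kernel.

PROVED: `|ω_D| ≤ 1`; `ω_D(v) = 0` unless `D ∣ n(v)` (`D` square-free); periodicity of `ω_D` modulo
any `M` with `4D ∣ M` (`genusWt_congr`); oddness `ω_D(-v) = -χ₄(D) ω_D(v)` (`genusWt_neg`); and the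
**`Γ₀(64)`-invariance `ω_D(ι(v)∘g) = ω_D(ι(v))`** (`genusWt_actInt`), whose content is the cone lemma:
if `p ∣ n(v)` and `p ∤ v₀` then `64v₀ · ι(v)(s,t) = (64v₀s + 64v₁t)² - 64n(v)t²`, so every value of
`ι(v)` prime to `p` has Legendre symbol `(v₀/p)` (`jacobiSym_binVal_of_not_dvd`), while if `p ∣ v₀`
then `p ∣ v₁` and `ι(v) ≡ v₂Y²` (`binVal_modEq_of_dvd_zero`). No named facts are introduced.

## References

* T. Shintani, *On construction of holomorphic cusp forms of half integral weight*, Nagoya Math. J.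
  58 (1975) 83–126, §2, Thm. 2 (lattice `L`, characters on `L*/L`). [Shintani1975]
* W. Kohnen, *Fourier coefficients of modular forms of half-integral weight*, Math. Ann. 271 (1985)
  237–268, §1 (the genus character `ω_D`).
* B. Gross, W. Kohnen, D. Zagier, *Heegner points and derivatives of L-series. II*, Math. Ann. 278
  (1987) 497–562, §1.1–1.2 (`χ_D(Q)` and its local description).
-/

namespace Literature.NumberTheory.EllipticCurves.Shintani

/-! ### The reduced discriminant -/

/-- The reduced discriminant `n(v) = 64 v₁² - v₀ v₂` (`disc ι(v) = 256 n(v)`). [folklore] -/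
def nQ (v : Fin 3 → ℤ) : ℤ := 64 * v 1 ^ 2 - v 0 * v 2

/-- Its polar form `B(v, u) = n(v + u) - n(v) - n(u) = 128 v₁u₁ - v₀u₂ - v₂u₀`. [folklore] -/
def bQ (v u : Fin 3 → ℤ) : ℤ := 128 * v 1 * u 1 - v 0 * u 2 - v 2 * u 0

/-- `nQ_add` (auxiliary). [folklore] -/
theorem nQ_add (v u : Fin 3 → ℤ) : nQ (v + u) = nQ v + bQ v u + nQ u := by
  simp only [nQ, bQ, Pi.add_apply]; ring

/-- `nQ_neg` (auxiliary). [folklore] -/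
theorem nQ_neg (v : Fin 3 → ℤ) : nQ (-v) = nQ v := by
  simp only [nQ, Pi.neg_apply]; ring

/-- `nQ_smul` (auxiliary). [folklore] -/
theorem nQ_smul (t : ℤ) (v : Fin 3 → ℤ) : nQ (t • v) = t ^ 2 * nQ v := by
  simp only [nQ, Pi.smul_apply, smul_eq_mul]; ring

/-- `bQ_smul_right` (auxiliary). [folklore] -/
theorem bQ_smul_right (t : ℤ) (v u : Fin 3 → ℤ) : bQ v (t • u) = t * bQ v u := by
  simp only [bQ, Pi.smul_apply, smul_eq_mul]; ring

/-! ### The action of `Γ₀(64)` on `L` in coordinates -/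

/-- For `g = (a b; 64c' d)`: coordinates of `ι(v) ∘ g` in `L`, where
`(x ∘ g)(X, Y) = x(aX + bY, 64c'X + dY)`. [folklore] -/
def actInt (a b c' d : ℤ) (v : Fin 3 → ℤ) : Fin 3 → ℤ :=
  ![v 0 * a ^ 2 + 128 * v 1 * a * c' + 64 * v 2 * c' ^ 2,
    v 0 * a * b + v 1 * (a * d + 64 * b * c') + v 2 * c' * d,
    64 * v 0 * b ^ 2 + 128 * v 1 * b * d + v 2 * d ^ 2]

/-- `actInt_zero` (auxiliary). [folklore] -/
@[simp] theorem actInt_zero (a b c' d : ℤ) (v : Fin 3 → ℤ) :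
    actInt a b c' d v 0 = v 0 * a ^ 2 + 128 * v 1 * a * c' + 64 * v 2 * c' ^ 2 := rfl
/-- `actInt_one` (auxiliary). [folklore] -/
@[simp] theorem actInt_one (a b c' d : ℤ) (v : Fin 3 → ℤ) :
    actInt a b c' d v 1 = v 0 * a * b + v 1 * (a * d + 64 * b * c') + v 2 * c' * d := rfl
/-- `actInt_two` (auxiliary). [folklore] -/
@[simp] theorem actInt_two (a b c' d : ℤ) (v : Fin 3 → ℤ) :
    actInt a b c' d v 2 = 64 * v 0 * b ^ 2 + 128 * v 1 * b * d + v 2 * d ^ 2 := rfl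

/-- `n(ι(v) ∘ g) = (det g)² n(v)`. [folklore] -/
theorem nQ_actInt_eq (a b c' d : ℤ) (v : Fin 3 → ℤ) :
    nQ (actInt a b c' d v) = (a * d - 64 * b * c') ^ 2 * nQ v := by
  simp only [nQ, actInt_zero, actInt_one, actInt_two]; ring

/-- `n` is invariant: `n(actInt g v) = n(v)` when `ad - 64bc' = 1`. [folklore] -/
theorem nQ_actInt {a b c' d : ℤ} (hdet : a * d - 64 * b * c' = 1) (v : Fin 3 → ℤ) :
    nQ (actInt a b c' d v) = nQ v := by
  rw [nQ_actInt_eq, hdet, one_pow, one_mul]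

/-- Composition: `actInt g (actInt g' v) = actInt (g' g) v` for `g, g'` with `64 ∣ c`. [folklore] -/
theorem actInt_actInt (a b c' d a₁ b₁ c₁' d₁ : ℤ) (v : Fin 3 → ℤ) :
    actInt a b c' d (actInt a₁ b₁ c₁' d₁ v) =
      actInt (a₁ * a + 64 * b₁ * c') (a₁ * b + b₁ * d) (c₁' * a + d₁ * c') (64 * c₁' * b + d₁ * d) v := by
  funext i
  fin_cases i <;> simp [actInt] <;> ring

/-- The identity acts trivially. [folklore] -/
theorem actInt_one_zero (v : Fin 3 → ℤ) : actInt 1 0 0 1 v = v := by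
  funext i
  fin_cases i <;> simp [actInt]

/-- `v ↦ actInt g v` is a bijection of `ℤ³` for `g = (a b; 64c' d)` of determinant `1`
(inverse `g⁻¹ = (d -b; -64c' a)`). [folklore] -/
def actEquiv (a b c' d : ℤ) (hdet : a * d - 64 * b * c' = 1) : (Fin 3 → ℤ) ≃ (Fin 3 → ℤ) where
  toFun := actInt a b c' d
  invFun := actInt d (-b) (-c') a
  left_inv v := by
    rw [actInt_actInt]
    have e1 : a * d + 64 * b * -c' = 1 := by linear_combination hdet
    have e2 : a * -b + b * a = 0 := by ring
    have e3 : c' * d + d * -c' = 0 := by ring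
    have e4 : 64 * c' * -b + d * a = 1 := by linear_combination hdet
    rw [e1, e2, e3, e4, actInt_one_zero]
  right_inv v := by
    rw [actInt_actInt]
    have e1 : d * a + 64 * -b * c' = 1 := by linear_combination hdet
    have e2 : d * b + -b * d = 0 := by ring
    have e3 : -c' * a + a * c' = 0 := by ring
    have e4 : 64 * -c' * b + a * d = 1 := by linear_combination hdet
    rw [e1, e2, e3, e4, actInt_one_zero]

/-- `actEquiv_apply` (auxiliary). [folklore] -/
@[simp] theorem actEquiv_apply (a b c' d : ℤ) (hdet : a * d - 64 * b * c' = 1) (v : Fin 3 → ℤ) :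
    actEquiv a b c' d hdet v = actInt a b c' d v := rfl

/-! ### The local genus symbols `Ω_p` and the weight `ω_D` -/

/-- **The local genus symbol** at an odd prime `p` of the binary form `ι(v) = [64v₀, 128v₁, v₂]`:
`0` unless `p ∣ n(v)` (i.e. `ι(v)` is singular mod `p`, `ι(v) ≡ λ ℓ²`), and then the Legendre symbol
`(λ/p)` of the unit square class represented by `ι(v)` mod `p`, read off from the coefficient `v₀`
(the value at `(1,0)`, up to the square `64`) or, if `p ∣ v₀`, from `v₂` (the value at `(0,1)`);
`0` if `ι(v) ≡ 0 (mod p)`. This is the `p`-component of the generic character of Gauss attached to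
the prime discriminant `p* = (-1)^{(p-1)/2} p` (Kohnen 1985, §1, `χ_D`; Gross–Kohnen–Zagier II, §1).
[cite: Shintani1975, §2 (characters `χ` on `L/NL`)] -/
def coneSym (p : ℕ) (v : Fin 3 → ℤ) : ℤ :=
  if (p : ℤ) ∣ nQ v then (if (p : ℤ) ∣ v 0 then jacobiSym (v 2) p else jacobiSym (v 0) p) else 0

/-- **The weight `ω_D(v) = χ₋₄(v₂) · ∏_{p ∣ D} Ω_p(v)`** (`D` odd square-free): the genus character of
the discriminant `-4D`-type splitting on forms `ι(v)` with `D ∣ n(v)`, times the `2`-adic character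
`χ₋₄` of the odd coefficient `v₂`; it vanishes unless `D ∣ n(v)`. [cite: Shintani1975, Thm. 2 (`v = χ(x₁)`)] -/
def genusWt (D : ℕ) (v : Fin 3 → ℤ) : ℤ :=
  ZMod.χ₄ (v 2) * ∏ p ∈ D.primeFactors, coneSym p v

/-- `coneSym_of_not_dvd` (auxiliary). [folklore] -/
theorem coneSym_of_not_dvd {p : ℕ} {v : Fin 3 → ℤ} (h : ¬ (p : ℤ) ∣ nQ v) : coneSym p v = 0 := by
  simp [coneSym, h]

/-- `abs_jacobiSym_le` (auxiliary). [folklore] -/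
theorem abs_jacobiSym_le (a : ℤ) (b : ℕ) : |jacobiSym a b| ≤ 1 := by
  rcases jacobiSym.trichotomy a b with h | h | h <;> rw [h] <;> simp

/-- `abs_coneSym_le` (auxiliary). [folklore] -/
theorem abs_coneSym_le (p : ℕ) (v : Fin 3 → ℤ) : |coneSym p v| ≤ 1 := by
  unfold coneSym
  split_ifs
  · exact abs_jacobiSym_le _ _
  · exact abs_jacobiSym_le _ _
  · simp

/-- `abs_χ₄_le` (auxiliary). [folklore] -/
theorem abs_χ₄_le (n : ℤ) : |(ZMod.χ₄ n : ℤ)| ≤ 1 := by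
  rw [ZMod.χ₄_int_eq_if_mod_four]
  split_ifs <;> simp

/-- `abs_genusWt_le` (auxiliary). [folklore] -/
theorem abs_genusWt_le (D : ℕ) (v : Fin 3 → ℤ) : |genusWt D v| ≤ 1 := by
  unfold genusWt
  rw [abs_mul, Finset.abs_prod]
  have h1 := abs_χ₄_le (v 2)
  have h2 : ∏ p ∈ D.primeFactors, |coneSym p v| ≤ 1 := by
    apply Finset.prod_le_one (fun _ _ ↦ abs_nonneg _) (fun p _ ↦ abs_coneSym_le p v)
  have h3 : (0 : ℤ) ≤ ∏ p ∈ D.primeFactors, |coneSym p v| := Finset.prod_nonneg fun _ _ ↦ abs_nonneg _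
  nlinarith [abs_nonneg (ZMod.χ₄ (v 2) : ℤ)]

/-- A square-free `D` divides `n` as soon as all its prime factors do. [folklore] -/
theorem natCast_dvd_of_primeFactors_dvd {D : ℕ} (hD : Squarefree D) {n : ℤ}
    (hall : ∀ p ∈ D.primeFactors, (p : ℤ) ∣ n) : (D : ℤ) ∣ n := by
  rw [Int.natCast_dvd]
  rw [← Nat.prod_primeFactors_of_squarefree hD]
  apply Finset.prod_primes_dvd
  · exact fun p hp ↦ (Nat.prime_of_mem_primeFactors hp).prime
  · intro p hp
    exact Int.natCast_dvd.mp (hall p hp)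

/-- `ω_D(v) = 0` unless `D ∣ n(v)` (`D` square-free). [folklore] -/
theorem genusWt_of_not_dvd {D : ℕ} (hD : Squarefree D) {v : Fin 3 → ℤ} (h : ¬ (D : ℤ) ∣ nQ v) :
    genusWt D v = 0 := by
  unfold genusWt
  by_contra hne
  apply h
  apply natCast_dvd_of_primeFactors_dvd hD
  intro p hp
  by_contra hpn
  apply hne
  rw [Finset.prod_eq_zero hp (coneSym_of_not_dvd hpn), mul_zero]

/-! #### Periodicity -/

/-- `n` respects congruences. [folklore] -/
theorem nQ_emod_congr {M : ℤ} {v u : Fin 3 → ℤ} (h : ∀ i, v i ≡ u i [ZMOD M]) :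
    nQ v ≡ nQ u [ZMOD M] := by
  unfold nQ
  have h0 := h 0; have h1 := h 1; have h2 := h 2
  exact ((h1.pow 2).mul_left 64).sub (h0.mul h2)

/-- `coneSym_congr` (auxiliary). [folklore] -/
theorem coneSym_congr {p : ℕ} {M : ℤ} (hpM : (p : ℤ) ∣ M) {v u : Fin 3 → ℤ}
    (h : ∀ i, v i ≡ u i [ZMOD M]) : coneSym p v = coneSym p u := by
  have h' : ∀ i, v i ≡ u i [ZMOD p] := fun i ↦ (h i).of_dvd hpM
  have hn : nQ v ≡ nQ u [ZMOD p] := nQ_emod_congr h'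
  have e1 : ((p : ℤ) ∣ nQ v) ↔ ((p : ℤ) ∣ nQ u) := by
    rw [Int.dvd_iff_emod_eq_zero, Int.dvd_iff_emod_eq_zero, hn]
  have e2 : ((p : ℤ) ∣ v 0) ↔ ((p : ℤ) ∣ u 0) := by
    rw [Int.dvd_iff_emod_eq_zero, Int.dvd_iff_emod_eq_zero, h' 0]
  unfold coneSym
  rw [jacobiSym.mod_left' (h' 2), jacobiSym.mod_left' (h' 0)]
  by_cases hv : (p : ℤ) ∣ nQ v
  · rw [if_pos hv, if_pos (e1.mp hv)]
    by_cases hv0 : (p : ℤ) ∣ v 0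
    · rw [if_pos hv0, if_pos (e2.mp hv0)]
    · rw [if_neg hv0, if_neg (mt e2.mpr hv0)]
  · rw [if_neg hv, if_neg (mt e1.mpr hv)]

/-- `χ₄_congr` (auxiliary). [folklore] -/
theorem χ₄_congr {M : ℤ} (h4 : (4 : ℤ) ∣ M) {a b : ℤ} (h : a ≡ b [ZMOD M]) :
    ZMod.χ₄ a = ZMod.χ₄ b := by
  have h' : a ≡ b [ZMOD 4] := h.of_dvd h4
  rw [ZMod.χ₄_int_mod_four a, ZMod.χ₄_int_mod_four b, h']

/-- **Periodicity**: `ω_D` depends on `v` only modulo `M` whenever `4 ∣ M` and `D ∣ M`. [folklore] -/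
theorem genusWt_congr {D : ℕ} {M : ℤ} (h4 : (4 : ℤ) ∣ M) (hDM : (D : ℤ) ∣ M) {v u : Fin 3 → ℤ}
    (h : ∀ i, v i ≡ u i [ZMOD M]) : genusWt D v = genusWt D u := by
  unfold genusWt
  rw [χ₄_congr h4 (h 2)]
  congr 1
  refine Finset.prod_congr rfl fun p hp ↦ coneSym_congr ?_ h
  exact dvd_trans (Int.natCast_dvd_natCast.mpr (Nat.dvd_of_mem_primeFactors hp)) hDM

/-! #### Oddness -/

/-- `Ω_p(-v) = χ₄(p) Ω_p(v)` (`(-1/p) = χ₄(p)`). [folklore] -/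
theorem coneSym_neg {p : ℕ} (hp : Odd p) (v : Fin 3 → ℤ) :
    coneSym p (-v) = ZMod.χ₄ p * coneSym p v := by
  unfold coneSym
  rw [nQ_neg]
  simp only [Pi.neg_apply, dvd_neg]
  split_ifs
  · exact jacobiSym.neg _ hp
  · exact jacobiSym.neg _ hp
  · simp

/-- `∏_{p ∣ D} χ₄(p) = χ₄(D)` for square-free `D`. [folklore] -/
theorem prod_χ₄_primeFactors {D : ℕ} (hD : Squarefree D) :
    ∏ p ∈ D.primeFactors, (ZMod.χ₄ p : ℤ) = ZMod.χ₄ D := by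
  conv_rhs => rw [← Nat.prod_primeFactors_of_squarefree hD]
  rw [Nat.cast_prod, map_prod]

/-- **Oddness of the weight**: `ω_D(-v) = -χ₄(D) ω_D(v)` (`D` odd square-free); in particular
`ω_D` is odd for `D ≡ 1 (mod 4)` and even for `D ≡ 3 (mod 4)`. [folklore] -/
theorem genusWt_neg {D : ℕ} (hD : Squarefree D) (hDodd : Odd D) (v : Fin 3 → ℤ) :
    genusWt D (-v) = -(ZMod.χ₄ D * genusWt D v) := by
  unfold genusWt
  have hodd : ∀ p ∈ D.primeFactors, Odd p := fun p hp ↦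
    hDodd.of_dvd_nat (Nat.dvd_of_mem_primeFactors hp)
  rw [Finset.prod_congr rfl fun p hp ↦ coneSym_neg (hodd p hp) v, Finset.prod_mul_distrib,
    prod_χ₄_primeFactors hD, Pi.neg_apply]
  have hneg : (ZMod.χ₄ ((-v 2 : ℤ) : ZMod 4) : ℤ) = -ZMod.χ₄ ((v 2 : ℤ) : ZMod 4) := by
    rw [Int.cast_neg, neg_eq_neg_one_mul, map_mul]
    have hm1 : (ZMod.χ₄ (-1 : ZMod 4) : ℤ) = -1 := by decide
    rw [hm1]; ring
  rw [hneg]; ring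

/-! #### Invariance of `Ω_p` under `Γ₀(64)` (the cone `ι(v) ≡ λ ℓ² (mod p)`) -/

/-- Values of the binary form `ι(v)`: `ι(v)(s, t) = 64 v₀ s² + 128 v₁ s t + v₂ t²`. [folklore] -/
def binVal (v : Fin 3 → ℤ) (s t : ℤ) : ℤ := 64 * v 0 * s ^ 2 + 128 * v 1 * s * t + v 2 * t ^ 2

/-- Completing the square: `64 v₀ · ι(v)(s,t) = (64 v₀ s + 64 v₁ t)² - 64 n(v) t²`. [folklore] -/
theorem mul_binVal_eq (v : Fin 3 → ℤ) (s t : ℤ) :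
    64 * v 0 * binVal v s t = (64 * v 0 * s + 64 * v 1 * t) ^ 2 - 64 * nQ v * t ^ 2 := by
  simp only [binVal, nQ]; ring

/-- `actInt_zero_eq` (auxiliary). [folklore] -/
theorem actInt_zero_eq (a b c' d : ℤ) (v : Fin 3 → ℤ) :
    64 * actInt a b c' d v 0 = binVal v a (64 * c') := by
  simp only [actInt_zero, binVal]; ring

/-- `actInt_two_eq` (auxiliary). [folklore] -/
theorem actInt_two_eq (a b c' d : ℤ) (v : Fin 3 → ℤ) : actInt a b c' d v 2 = binVal v b d := by
  simp only [actInt_two, binVal]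

section ConeLemmas

variable {p : ℕ} [hp : Fact p.Prime]

/-- `jacobiSym_eq_quadraticChar` (auxiliary). [folklore] -/
theorem jacobiSym_eq_quadraticChar (x : ℤ) :
    jacobiSym x p = quadraticChar (ZMod p) (x : ZMod p) := by
  rw [← jacobiSym.legendreSym.to_jacobiSym]; rfl

/-- `intCast_zmod_eq_zero_iff` (auxiliary). [folklore] -/
theorem intCast_zmod_eq_zero_iff (x : ℤ) : ((x : ZMod p) = 0) ↔ (p : ℤ) ∣ x :=
  ZMod.intCast_zmod_eq_zero_iff_dvd x p

/-- `two_ne_zero_zmod` (auxiliary). [folklore] -/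
theorem two_ne_zero_zmod (hp2 : p ≠ 2) : (2 : ZMod p) ≠ 0 := by
  intro h
  have : ((2 : ℕ) : ZMod p) = 0 := by exact_mod_cast h
  rw [ZMod.natCast_eq_zero_iff] at this
  have h2 : p ≤ 2 := Nat.le_of_dvd (by norm_num) this
  have := hp.out.two_le
  omega

/-- `c64_ne_zero_zmod` (auxiliary). [folklore] -/
theorem c64_ne_zero_zmod (hp2 : p ≠ 2) : (64 : ZMod p) ≠ 0 := by
  have h2 := two_ne_zero_zmod hp2
  have : (64 : ZMod p) = 2 ^ 6 := by norm_num
  rw [this]; exact pow_ne_zero _ h2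

/-- **Lemma A** (unit leading coefficient): if `p ∣ n(v)`, `p ∤ v₀`, then every value of `ι(v)` prime
to `p` has Legendre symbol `(v₀/p)` (`ι(v) ≡ (64v₀)⁻¹ ℓ²`, `ℓ = 64v₀ X + 64v₁ Y`). [folklore] -/
theorem jacobiSym_binVal_of_not_dvd (hp2 : p ≠ 2) {v : Fin 3 → ℤ} (hn : (p : ℤ) ∣ nQ v)
    (hv0 : ¬ (p : ℤ) ∣ v 0) {s t : ℤ} (hval : ¬ (p : ℤ) ∣ binVal v s t) :
    jacobiSym (binVal v s t) p = jacobiSym (v 0) p := by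
  rw [jacobiSym_eq_quadraticChar, jacobiSym_eq_quadraticChar]
  have hnz : ((nQ v : ℤ) : ZMod p) = 0 := (intCast_zmod_eq_zero_iff _).mpr hn
  have hv0' : ((v 0 : ℤ) : ZMod p) ≠ 0 := fun h ↦ hv0 ((intCast_zmod_eq_zero_iff _).mp h)
  have hval' : ((binVal v s t : ℤ) : ZMod p) ≠ 0 := fun h ↦ hval ((intCast_zmod_eq_zero_iff _).mp h)
  have key : (64 : ZMod p) * (v 0 : ℤ) * (binVal v s t : ℤ) =
      ((64 * v 0 * s + 64 * v 1 * t : ℤ) : ZMod p) ^ 2 := by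
    have := congrArg (fun z : ℤ ↦ (z : ZMod p)) (mul_binVal_eq v s t)
    push_cast at this ⊢
    rw [this, hnz]; ring
  have h64 := c64_ne_zero_zmod (p := p) hp2
  have hL : ((64 * v 0 * s + 64 * v 1 * t : ℤ) : ZMod p) ≠ 0 := by
    intro h0
    rw [h0, zero_pow two_ne_zero] at key
    rcases mul_eq_zero.mp key with h1 | h1
    · rcases mul_eq_zero.mp h1 with h2 | h2
      · exact h64 h2
      · exact hv0' h2
    · exact hval' h1
  have hsq : quadraticChar (ZMod p) (((64 * v 0 * s + 64 * v 1 * t : ℤ) : ZMod p) ^ 2) = 1 :=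
    quadraticChar_sq_one' hL
  rw [← key, map_mul, map_mul] at hsq
  have h64sq : quadraticChar (ZMod p) (64 : ZMod p) = 1 := by
    have : (64 : ZMod p) = 8 ^ 2 := by norm_num
    rw [this]
    exact quadraticChar_sq_one' (by
      intro h8
      apply h64
      have : (64 : ZMod p) = 8 * 8 := by norm_num
      rw [this, h8, mul_zero])
  rw [h64sq, one_mul] at hsq
  -- `χ(v₀) χ(val) = 1` with `χ(v₀) = ±1`
  rcases quadraticChar_dichotomy hv0' with h1 | h1
  · rw [h1, one_mul] at hsq; rw [hsq, h1]
  · rw [h1] at hsq ⊢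
    linear_combination -hsq

/-- In the situation of Lemma A, `p ∣ ι(v)(s,t)` forces `p ∣ ℓ(s,t) = 64v₀s + 64v₁t`. [folklore] -/
theorem dvd_lin_of_dvd_binVal {v : Fin 3 → ℤ} (hn : (p : ℤ) ∣ nQ v)
    {s t : ℤ} (hval : (p : ℤ) ∣ binVal v s t) : (p : ℤ) ∣ 64 * v 0 * s + 64 * v 1 * t := by
  rw [← intCast_zmod_eq_zero_iff] at hval hn ⊢
  have key : ((64 * v 0 * s + 64 * v 1 * t : ℤ) : ZMod p) ^ 2 = 0 := by
    have := congrArg (fun z : ℤ ↦ (z : ZMod p)) (mul_binVal_eq v s t)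
    push_cast at this hval hn ⊢
    rw [hval, hn] at this
    linear_combination -this
  exact pow_eq_zero_iff two_ne_zero |>.mp key

/-- `dvd_iff_of_modEq` (auxiliary). [folklore] -/
theorem dvd_iff_of_modEq {n a b : ℤ} (h : a ≡ b [ZMOD n]) : n ∣ a ↔ n ∣ b := by
  rw [Int.dvd_iff_emod_eq_zero, Int.dvd_iff_emod_eq_zero, h]

/-- **Lemma B** (`p ∣ v₀`): then `p ∣ v₁` and `ι(v)(s,t) ≡ v₂ t² (mod p)`. [folklore] -/
theorem dvd_one_of_dvd_zero (hp2 : p ≠ 2) {v : Fin 3 → ℤ} (hn : (p : ℤ) ∣ nQ v)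
    (hv0 : (p : ℤ) ∣ v 0) : (p : ℤ) ∣ v 1 := by
  rw [← intCast_zmod_eq_zero_iff] at hn hv0 ⊢
  have h64 := c64_ne_zero_zmod (p := p) hp2
  unfold nQ at hn
  push_cast at hn
  rw [hv0, zero_mul, sub_zero] at hn
  rcases mul_eq_zero.mp hn with h | h
  · exact absurd h h64
  · exact pow_eq_zero_iff two_ne_zero |>.mp h

/-- `binVal_modEq_of_dvd_zero` (auxiliary). [folklore] -/
theorem binVal_modEq_of_dvd_zero (hp2 : p ≠ 2) {v : Fin 3 → ℤ} (hn : (p : ℤ) ∣ nQ v)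
    (hv0 : (p : ℤ) ∣ v 0) (s t : ℤ) : binVal v s t ≡ v 2 * t ^ 2 [ZMOD p] := by
  have hv1 := dvd_one_of_dvd_zero hp2 hn hv0
  unfold binVal
  have h1 : 64 * v 0 * s ^ 2 ≡ 0 [ZMOD p] :=
    Int.modEq_zero_iff_dvd.mpr (dvd_mul_of_dvd_left (dvd_mul_of_dvd_right hv0 _) _)
  have h2 : 128 * v 1 * s * t ≡ 0 [ZMOD p] :=
    Int.modEq_zero_iff_dvd.mpr (dvd_mul_of_dvd_left (dvd_mul_of_dvd_left
      (dvd_mul_of_dvd_right hv1 _) _) _)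
  have := (h1.add h2).add (Int.ModEq.refl (v 2 * t ^ 2))
  simpa using this

/-- `J(x t² | p) = J(x | p)` for `p ∤ t`. [folklore] -/
theorem jacobiSym_mul_sq {x t : ℤ} (ht : ¬ (p : ℤ) ∣ t) : jacobiSym (x * t ^ 2) p = jacobiSym x p := by
  rw [jacobiSym_eq_quadraticChar, jacobiSym_eq_quadraticChar]
  push_cast
  rw [map_mul, quadraticChar_sq_one' (fun h ↦ ht ((intCast_zmod_eq_zero_iff _).mp h)),
    mul_one]

/-- `jacobiSym_eq_zero_of_dvd` (auxiliary). [folklore] -/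
theorem jacobiSym_eq_zero_of_dvd {x : ℤ} (hx : (p : ℤ) ∣ x) : jacobiSym x p = 0 := by
  rw [jacobiSym_eq_quadraticChar, (intCast_zmod_eq_zero_iff x).mpr hx, quadraticChar_zero]

/-- **`Ω_p` is `Γ₀(64)`-invariant**: `Ω_p(ι(v) ∘ g) = Ω_p(ι(v))` for `g = (a b; 64c' d) ∈ SL₂(ℤ)`,
`p` an odd prime. [folklore] -/
theorem coneSym_actInt (hp2 : p ≠ 2) {a b c' d : ℤ} (hdet : a * d - 64 * b * c' = 1)
    (v : Fin 3 → ℤ) : coneSym p (actInt a b c' d v) = coneSym p v := by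
  unfold coneSym
  rw [nQ_actInt hdet]
  by_cases hn : (p : ℤ) ∣ nQ v
  swap
  · rw [if_neg hn, if_neg hn]
  rw [if_pos hn, if_pos hn]
  set v' := actInt a b c' d v with hv'
  have e0 : 64 * v' 0 = binVal v a (64 * c') := actInt_zero_eq a b c' d v
  have e2 : v' 2 = binVal v b d := actInt_two_eq a b c' d v
  have hp' : Prime (p : ℤ) := Nat.prime_iff_prime_int.mp hp.out
  have h64p : ¬ (p : ℤ) ∣ 64 := by
    intro h
    have : ((64 : ℤ) : ZMod p) = 0 := (intCast_zmod_eq_zero_iff _).mpr h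
    exact c64_ne_zero_zmod (p := p) hp2 (by exact_mod_cast this)
  -- `p ∣ v'₀ ↔ p ∣ ι(v)(a, 64c')`
  have hdvd0 : (p : ℤ) ∣ v' 0 ↔ (p : ℤ) ∣ binVal v a (64 * c') := by
    rw [← e0]
    constructor
    · exact fun h ↦ dvd_mul_of_dvd_right h _
    · intro h
      exact (hp'.dvd_or_dvd h).resolve_left h64p
  by_cases hv0 : (p : ℤ) ∣ v 0
  · -- Lemma B regime: `p ∣ v₀`, `p ∣ v₁`
    rw [if_pos hv0]
    have hmod0 : binVal v a (64 * c') ≡ v 2 * (64 * c') ^ 2 [ZMOD p] :=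
      binVal_modEq_of_dvd_zero hp2 hn hv0 a (64 * c')
    have hmod2 : v' 2 ≡ v 2 * d ^ 2 [ZMOD p] := by
      rw [e2]; exact binVal_modEq_of_dvd_zero hp2 hn hv0 b d
    by_cases hv0' : (p : ℤ) ∣ v' 0
    · rw [if_pos hv0', jacobiSym.mod_left' hmod2]
      by_cases hv2 : (p : ℤ) ∣ v 2
      · rw [jacobiSym_eq_zero_of_dvd hv2, jacobiSym_eq_zero_of_dvd (dvd_mul_of_dvd_left hv2 _)]
      · -- then `p ∣ c'`, hence `p ∤ d`
        have hval := hdvd0.mp hv0'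
        have h1 : (p : ℤ) ∣ v 2 * (64 * c') ^ 2 := (dvd_iff_of_modEq hmod0).mp hval
        have hc' : (p : ℤ) ∣ c' := by
          rcases hp'.dvd_or_dvd h1 with h | h
          · exact absurd h hv2
          · have h' := hp'.dvd_of_dvd_pow h
            rcases hp'.dvd_or_dvd h' with h'' | h''
            · exact absurd h'' h64p
            · exact h''
        have hd : ¬ (p : ℤ) ∣ d := by
          intro hd
          have : (p : ℤ) ∣ a * d - 64 * b * c' :=
            dvd_sub (dvd_mul_of_dvd_right hd _) (dvd_mul_of_dvd_right hc' _)
          rw [hdet] at this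
          exact hp'.not_dvd_one this
        rw [jacobiSym_mul_sq hd]
    · rw [if_neg hv0']
      have hval : ¬ (p : ℤ) ∣ binVal v a (64 * c') := fun h ↦ hv0' (hdvd0.mpr h)
      have h1 : ¬ (p : ℤ) ∣ v 2 * (64 * c') ^ 2 := fun h ↦ hval ((dvd_iff_of_modEq hmod0).mpr h)
      have hc8 : ¬ (p : ℤ) ∣ 64 * c' := fun h ↦ h1 (dvd_mul_of_dvd_right (dvd_pow h two_ne_zero) _)
      -- `J(v'₀) = J(64 v'₀) = J(ι(v)(a,64c')) = J(v₂ (64c')²) = J(v₂)`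
      have : jacobiSym (v' 0) p = jacobiSym (64 * v' 0) p := by
        rw [show (64 : ℤ) * v' 0 = v' 0 * 8 ^ 2 by ring, jacobiSym_mul_sq]
        intro h8
        exact h64p (by have := dvd_mul_of_dvd_left h8 8; simpa using this)
      rw [this, e0, jacobiSym.mod_left' hmod0, jacobiSym_mul_sq hc8]
  · -- Lemma A regime
    rw [if_neg hv0]
    by_cases hv0' : (p : ℤ) ∣ v' 0
    · rw [if_pos hv0', e2]
      apply jacobiSym_binVal_of_not_dvd hp2 hn hv0
      intro hbd
      have hL1 := dvd_lin_of_dvd_binVal hn (hdvd0.mp hv0')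
      have hL2 := dvd_lin_of_dvd_binVal hn hbd
      have : (p : ℤ) ∣ d * (64 * v 0 * a + 64 * v 1 * (64 * c')) - 64 * c' * (64 * v 0 * b + 64 * v 1 * d) :=
        dvd_sub (dvd_mul_of_dvd_right hL1 _) (dvd_mul_of_dvd_right hL2 _)
      have e : d * (64 * v 0 * a + 64 * v 1 * (64 * c')) - 64 * c' * (64 * v 0 * b + 64 * v 1 * d) =
          64 * v 0 * (a * d - 64 * b * c') := by ring
      rw [e, hdet, mul_one] at this
      rcases hp'.dvd_or_dvd this with h | h
      · exact h64p h
      · exact hv0 h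
    · rw [if_neg hv0']
      have hval : ¬ (p : ℤ) ∣ binVal v a (64 * c') := fun h ↦ hv0' (hdvd0.mpr h)
      have : jacobiSym (v' 0) p = jacobiSym (64 * v' 0) p := by
        rw [show (64 : ℤ) * v' 0 = v' 0 * 8 ^ 2 by ring, jacobiSym_mul_sq]
        intro h8
        exact h64p (by have := dvd_mul_of_dvd_left h8 8; simpa using this)
      rw [this, e0]
      exact jacobiSym_binVal_of_not_dvd hp2 hn hv0 hval

end ConeLemmas

/-- `64 ∣ c`, `ad - bc = 1` forces `d` odd. [folklore] -/
theorem odd_d_of_det {a b c' d : ℤ} (hdet : a * d - 64 * b * c' = 1) : Odd d := by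
  by_contra hd
  rw [Int.not_odd_iff_even] at hd
  have : Even (a * d - 64 * b * c') := by
    apply Even.sub (hd.mul_left a)
    exact ⟨32 * b * c', by ring⟩
  rw [hdet] at this
  exact Int.not_even_one this

/-- **`ω_D` is `Γ₀(64)`-invariant** (`D` odd square-free). [folklore] -/
theorem genusWt_actInt {D : ℕ} (hDodd : Odd D) {a b c' d : ℤ}
    (hdet : a * d - 64 * b * c' = 1) (v : Fin 3 → ℤ) :
    genusWt D (actInt a b c' d v) = genusWt D v := by
  unfold genusWt
  have hd := odd_d_of_det hdet
  -- the `2`-adic character: `v'₂ = 64v₀b² + 128v₁bd + v₂d² ≡ v₂ (mod 4)`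
  have h2 : actInt a b c' d v 2 ≡ v 2 [ZMOD 4] := by
    rw [actInt_two]
    obtain ⟨k, hk⟩ := hd
    have : 64 * v 0 * b ^ 2 + 128 * v 1 * b * d + v 2 * d ^ 2 - v 2 =
        4 * (16 * v 0 * b ^ 2 + 32 * v 1 * b * d + v 2 * (k ^ 2 + k)) := by
      rw [hk]; ring
    exact (Int.modEq_iff_dvd.mpr ⟨-(16 * v 0 * b ^ 2 + 32 * v 1 * b * d + v 2 * (k ^ 2 + k)),
      by linear_combination -this⟩)
  rw [χ₄_congr (dvd_refl 4) h2]
  congr 1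
  refine Finset.prod_congr rfl fun p hp ↦ ?_
  have hpp := Nat.prime_of_mem_primeFactors hp
  haveI := Fact.mk hpp
  have hp2 : p ≠ 2 := by
    rintro rfl
    exact (Nat.not_even_iff_odd.mpr hDodd) (even_iff_two_dvd.mpr (Nat.dvd_of_mem_primeFactors hp))
  exact coneSym_actInt hp2 hdet v

end Literature.NumberTheory.EllipticCurves.Shintani
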